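import Literature.AlgebraicGeometry.GroupActions.FixedPointScheme
import Mathlib.AlgebraicGeometry.Morphisms.FinitePresentation
import Mathlib.RingTheory.Kaehler.Basic
import HarnessLib

/-!
# Fixed-point schemes of finite groups are locally of finite presentation over the ambient scheme

Literature topic `AlgebraicGeometry/GroupActions`; companion of `FixedPointScheme.lean` (interface
`IsFixedPointScheme`, construction `fixedPointScheme ρ` by iterated equalizers).  Everything here is
PROVED (no named facts); it is the finite-presentation input of the smoothness theorems for
fixed-point schemes (`FixedPointSchemeSmoothHolds.lean`: Conrad–Gabber–Prasad A.8.10(2),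
Edixhoven 1992 Prop. 3.4), typed for the cross-ladder literature layer of ladder HodgeAV, rung H3
(sub-home `lit-family`, tranche LT-H3 (b)).

## Contents (namespace `Literature.AlgebraicGeometry.GroupActions`)

* `locallyOfFinitePresentation_diagonal`: the diagonal `X → X ×_Y X` of a morphism `X → Y` that is
  locally of finite type is locally of finite presentation.  Affine case: for an `R`-algebra `B` of
  finite type the multiplication `B ⊗_R B → B` is surjective with kernel generated by the finitely
  many `bᵢ ⊗ 1 - 1 ⊗ bᵢ` [cite: GortzWedhorn2020, Prop. 9.4] (Mathlib `KaehlerDifferential.ideal_fg`);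
  the reduction to the affine case is the diagonal cover of [cite: GortzWedhorn2020, Prop. 9.5].
* `locallyOfFinitePresentation_of_comp`: cancellation — if `f ≫ g` is locally of finite
  presentation and `g` is locally of finite type then `f` is locally of finite presentation (the
  graph of `f` is a base change of the diagonal of `g`) [cite: GortzWedhorn2020, (9.1.4) and Prop. 9.5].
* `locallyOfFinitePresentation_equalizer_ι_left`: the equalizer `Eq(f, g) → X` of two `S`-morphisms
  into an `S`-scheme `Y` locally of finite type is locally of finite presentation (base change of
  the diagonal of `Y → S` along `(f, g)`, the cartesian square [cite: GortzWedhorn2020, (9.1.4)]).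
* `locallyOfFinitePresentation_commonFixedLocus`, `locallyOfFinitePresentation_fixedPointScheme_ι`,
  `IsFixedPointObject.locallyOfFinitePresentation_left`, `IsFixedPointScheme.locallyOfFinitePresentation`:
  for a FINITE group acting by `S`-automorphisms on `Y` locally of finite type over `S`, every
  fixed-point scheme `j : F ⟶ Y` has `j` locally of finite presentation, hence `F → S` is locally of
  finite presentation when `Y → S` is [cite: ConradGabberPrasad2015, Prop. A.8.10(1)] (the printed
  "locally of finite type" permanence, sharpened to finite presentation for finite groups).

No instances, no notation, no `sorry`, no named facts.
-/

universe u

open CategoryTheory CategoryTheory.Limits AlgebraicGeometry TensorProduct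

namespace Literature.AlgebraicGeometry.GroupActions

/-! ## The diagonal of a morphism locally of finite type -/

section Diagonal

variable {X Y Z : Scheme.{u}}

/-- Affine case: for an `R`-algebra `S` of finite type, the multiplication map `S ⊗[R] S → S` is
of finite presentation (surjective, kernel generated by the `sᵢ ⊗ 1 - 1 ⊗ sᵢ`)
[cite: GortzWedhorn2020, Prop. 9.4]. -/
theorem finitePresentation_lmul' (R S : Type u) [CommRing R] [CommRing S] [Algebra R S]
    [Algebra.FiniteType R S] :
    (Algebra.TensorProduct.lmul' R : S ⊗[R] S →ₐ[R] S).toRingHom.FinitePresentation := by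
  refine RingHom.FinitePresentation.of_surjective _ (fun s => ⟨s ⊗ₜ[R] 1, by simp⟩) ?_
  have h := KaehlerDifferential.ideal_fg R S
  exact h

open MorphismProperty in
/-- **The diagonal of a morphism locally of finite type is locally of finite presentation**
[cite: GortzWedhorn2020, Prop. 9.4 and Prop. 9.5]. -/
theorem locallyOfFinitePresentation_diagonal (f : X ⟶ Y) [LocallyOfFiniteType f] :
    LocallyOfFinitePresentation (pullback.diagonal f) := by
  wlog hX : (∃ S, X = Spec S) ∧ ∃ R, Y = Spec R
  · haveI hresp : MorphismProperty.Respects @LocallyOfFinitePresentation @IsOpenImmersion :=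
      HasRingHomProperty.respects_isOpenImmersion
        (RingHom.finitePresentation_stableUnderComposition.stableUnderCompositionWithLocalizationAway
          RingHom.finitePresentation_holdsForLocalizationAway).1
    let 𝒰Y := Y.affineCover
    let 𝒰X (j : (Y.affineCover.pullback₁ f).I₀) :
        ((Y.affineCover.pullback₁ f).X j).OpenCover := Scheme.affineCover _
    apply IsZariskiLocalAtTarget.of_range_subset_iSup _
      (Scheme.Pullback.range_diagonal_subset_diagonalCoverDiagonalRange f 𝒰Y 𝒰X)
    intro ⟨i, j⟩
    rw [arrow_mk_iso_iff (P := @LocallyOfFinitePresentation)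
      (Scheme.Pullback.diagonalRestrictIsoDiagonal f 𝒰Y 𝒰X i j)]
    have hfin : LocallyOfFiniteType ((𝒰X i).f j ≫ pullback.snd f (𝒰Y.f i)) :=
      comp_mem _ _ _ inferInstance (pullback_snd _ _ inferInstance)
    exact this _ ⟨⟨_, rfl⟩, ⟨_, rfl⟩⟩
  obtain ⟨⟨S, rfl⟩, R, rfl⟩ := hX
  obtain ⟨f, rfl⟩ := Spec.map_surjective f
  rw [HasRingHomProperty.Spec_iff (P := @LocallyOfFiniteType)] at *
  algebraize [f.hom]
  rw [show f = CommRingCat.ofHom (algebraMap R S) from rfl, diagonal_SpecMap R S,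
    cancel_right_of_respectsIso (P := @LocallyOfFinitePresentation),
    HasRingHomProperty.Spec_iff (P := @LocallyOfFinitePresentation)]
  exact finitePresentation_lmul' R S

/-- Cancellation: if `f ≫ g` is locally of finite presentation and `g` is locally of finite type,
then `f` is locally of finite presentation (`f` = graph of `f` followed by a base change of `f ≫ g`;
the graph is a base change of the diagonal of `g`) [cite: GortzWedhorn2020, (9.1.4) and Prop. 9.5]. -/
theorem locallyOfFinitePresentation_of_comp (f : X ⟶ Y) (g : Y ⟶ Z)
    [LocallyOfFinitePresentation (f ≫ g)] [LocallyOfFiniteType g] :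
    LocallyOfFinitePresentation f := by
  haveI : MorphismProperty.IsMultiplicative @LocallyOfFinitePresentation :=
    { id_mem := fun _ => inferInstance }
  have H : MorphismProperty.HasOfPostcompProperty
      @LocallyOfFinitePresentation @LocallyOfFiniteType := by
    rw [MorphismProperty.hasOfPostcompProperty_iff_le_diagonal]
    intro X Y f hf
    exact locallyOfFinitePresentation_diagonal f
  exact MorphismProperty.of_postcomp _ f g ‹_› ‹_›

end Diagonal

/-! ## Equalizers and fixed-point schemes -/

section Equalizer

variable {S : Scheme.{u}}

set_option backward.isDefEq.respectTransparency false in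
/-- The equalizer `Eq(f, g) → X` of two `S`-morphisms into an `S`-scheme locally of finite type is
locally of finite presentation: it is the base change of the diagonal of `Y → S` along `(f, g)`
[cite: GortzWedhorn2020, (9.1.4) and Prop. 9.5]. -/
theorem locallyOfFinitePresentation_equalizer_ι_left {X Y : Over S} [LocallyOfFiniteType Y.hom]
    (f g : X ⟶ Y) : LocallyOfFinitePresentation (equalizer.ι f g).left := by
  refine MorphismProperty.of_isPullback
    ((Limits.isPullback_equalizer_prod f g).map (Over.forget _)).flip ?_
  rw [← MorphismProperty.cancel_right_of_respectsIso @LocallyOfFinitePresentation _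
    (Over.prodLeftIsoPullback Y Y).hom]
  convert! (locallyOfFinitePresentation_diagonal Y.hom)
  ext1 <;> simp [← Over.comp_left]

variable {Y : Over S}

/-- The common fixed locus of a list of endomorphisms of an `S`-scheme locally of finite type is
locally of finite presentation over it [cite: GortzWedhorn2020, (9.2) and Prop. 9.5]. -/
theorem locallyOfFinitePresentation_commonFixedLocus [LocallyOfFiniteType Y.hom]
    (l : List (Y ⟶ Y)) : LocallyOfFinitePresentation (commonFixedLocus l).2.left := by
  induction l with
  | nil => rw [commonFixedLocus_nil]; dsimp only; rw [Over.id_left]; infer_instance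
  | cons f l ih =>
    rw [commonFixedLocus_cons]
    dsimp only
    rw [Over.comp_left]
    have := locallyOfFinitePresentation_equalizer_ι_left
      ((commonFixedLocus l).2 ≫ f) (commonFixedLocus l).2
    infer_instance

variable {G : Type*} [Group G]

/-- For a finite group acting on `Y` locally of finite type over `S`, the fixed-point scheme
`Y^G ⟶ Y` (iterated equalizers) is locally of finite presentation
[cite: ConradGabberPrasad2015, Prop. A.8.10(1)]. -/
theorem locallyOfFinitePresentation_fixedPointScheme_ι [Finite G] [LocallyOfFiniteType Y.hom]
    (ρ : G →* Aut Y) : LocallyOfFinitePresentation (fixedPointScheme.ι ρ).left :=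
  locallyOfFinitePresentation_commonFixedLocus _

/-- Any fixed-point object `j : F ⟶ Y` of a finite group action on `Y` locally of finite type
over `S` has `j` locally of finite presentation (uniqueness of the representing object)
[cite: ConradGabberPrasad2015, Prop. A.8.10(1)]. -/
theorem IsFixedPointObject.locallyOfFinitePresentation_left [Finite G] [LocallyOfFiniteType Y.hom]
    {F : Over S} {ρ : G →* Aut Y} {j : F ⟶ Y} (h : IsFixedPointObject ρ j) :
    LocallyOfFinitePresentation j.left := by
  rw [← h.iso_hom_comp (fixedPointScheme.isFixedPointObject ρ), Over.comp_left]
  have := locallyOfFinitePresentation_fixedPointScheme_ι ρ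
  infer_instance

/-- The structure map `j` of a fixed-point scheme of a finite group action on `Y` locally of
finite type over `S` is locally of finite presentation
[cite: ConradGabberPrasad2015, Prop. A.8.10(1)]. -/
theorem IsFixedPointScheme.locallyOfFinitePresentation_left [Finite G] [LocallyOfFiniteType Y.hom]
    {F : Over S} {ρ : G →* Aut Y} {j : F ⟶ Y} (h : IsFixedPointScheme ρ j) :
    LocallyOfFinitePresentation j.left :=
  h.toIsFixedPointObject.locallyOfFinitePresentation_left

/-- `Y^G → S` is locally of finite presentation if `Y → S` is (finite `G`)
[cite: ConradGabberPrasad2015, Prop. A.8.10(1)]. -/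
theorem IsFixedPointScheme.locallyOfFinitePresentation [Finite G] [LocallyOfFinitePresentation Y.hom]
    {F : Over S} {ρ : G →* Aut Y} {j : F ⟶ Y} (h : IsFixedPointScheme ρ j) :
    LocallyOfFinitePresentation F.hom := by
  have := h.locallyOfFinitePresentation_left
  rw [← Over.w j]
  infer_instance

/-- For an equivariant `S`-morphism `f : Y ⟶ Y'` locally of finite presentation between
`S`-schemes with actions of a finite group, `Y` locally of finite type over `S`, the induced
morphism of fixed-point schemes `fG : Y^G ⟶ Y'^G` (`fG ≫ j' = j ≫ f`) is locally of finite
presentation [cite: ConradGabberPrasad2015, Prop. A.8.10(1)–(2)]. -/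
theorem IsFixedPointScheme.locallyOfFinitePresentation_map [Finite G] [LocallyOfFiniteType Y.hom]
    {Y' F F' : Over S} {ρ : G →* Aut Y} {ρ' : G →* Aut Y'} {j : F ⟶ Y} {j' : F' ⟶ Y'}
    (hF : IsFixedPointScheme ρ j) (hF' : IsFixedPointScheme ρ' j') (f : Y ⟶ Y')
    [LocallyOfFinitePresentation f.left] (fG : F ⟶ F') (hfG : fG ≫ j' = j ≫ f) :
    LocallyOfFinitePresentation fG.left := by
  have := hF.locallyOfFinitePresentation_left
  have := hF'.isClosedImmersion
  have h1 : LocallyOfFinitePresentation (fG.left ≫ j'.left) := by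
    rw [← Over.comp_left, hfG, Over.comp_left]
    infer_instance
  exact locallyOfFinitePresentation_of_comp fG.left j'.left

end Equalizer

end Literature.AlgebraicGeometry.GroupActions
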